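import Summits.QuantumFields.GaugeBoot.FluctuationCoeffEquation
import Summits.QuantumFields.GaugeBoot.SymmetrizedMasterLoopUniqueness
import HarnessLib

/-!
# Fluctuations of Wilson loops, IX: weights and a priori bounds for block states (gauge-boot, ADDENDUM 32 part I)

HONEST FRAMING (cell `pub-gaugeboot`, page 1 of every file): the venture produces certified bounds
on lattice expectations at stated coupling, gauge group, dimension and torus size; NOT a mass gap,
NOT a continuum limit, NOT a string tension; NOT Yang–Mills-summit-bearing (barriers
`FixedCouplingUltralocality`, `PerturbativeInvisibility`).  Strong-coupling `SO(N)` lattice gauge theory with free boundary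
condition (S. Chatterjee, Comm. Math. Phys. **366** (2019); S. Chatterjee, J. Jafarov, arXiv:1604.04777); nothing about
four-dimensional continuum Yang–Mills or a mass gap.

## Content

Analytic inputs for the vanishing theorem on block states `σ = (B₀; C₁, …, C_m)` with flattening `u(σ) = B₀ ++ C₁ ++ ⋯ ++ C_m`:
(1) the blockwise one-component operator sums of a state are the operator sums of its flattening (`flatten_decomp`, for any
operator with the append law), hence the blockwise split/deform Catalan weight is `≤ |u| θ Φ_K(u)` (`block_weight_le`, from
the tree's `operator_weight_le`); (2) the a priori bound `|g_k(σ)| ≤ C D^m L^{|u(σ)|}` for the coefficients of the centered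
block products from the exponential bounds on the `1/N` coefficients (`centered_coeff_bound`); (3) congruence of the real block
operators under continuations that agree on GENUINE loop sequences (`SD_congr_gen`, …, `XM_congr_gen`), and genuineness of the
flattening / of the lists fed to the cross-merge continuations.

Everything is `[folklore]`/`[new (lane)]` bookkeeping given parts E–H and the tree's Catalan weight.
-/

noncomputable section

open Finset PowerSeries
open Literature.MathematicalPhysics.QuantumFieldTheory.Chatterjee2019LargeN
open Literature.MathematicalPhysics.QuantumFieldTheory.Chatterjee2019LargeN.CoeffCatalanBoundProof

namespace Summit.QuantumFields.GaugeBoot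

namespace StringDuality

variable {d : ℕ}

/-! ## Flattening -/

/-- A flattening of null-free / genuine blocks is null-free / genuine. [folklore] -/
theorem flatten_ne_nil_of {Cs : List (LoopSeq d)} (h : ∀ C ∈ Cs, ∀ l ∈ C, l ≠ []) : ∀ l ∈ Cs.flatten, l ≠ [] := by
  intro l hl
  obtain ⟨C, hC, hlC⟩ := List.mem_flatten.mp hl
  exact h C hC l hlC

/-- [folklore] -/
theorem isLoopSeq_flatten {Cs : List (LoopSeq d)} (h : ∀ C ∈ Cs, IsLoopSeq C) : IsLoopSeq Cs.flatten := by
  intro l hl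
  obtain ⟨C, hC, hlC⟩ := List.mem_flatten.mp hl
  exact h C hC l hlC

/-- Blocks of `Cs.set j C'` are blocks of `Cs` or `C'`. [folklore] -/
theorem forall_mem_set {Cs : List (LoopSeq d)} {P : LoopSeq d → Prop} (h : ∀ C ∈ Cs, P C) {C' : LoopSeq d} (hC' : P C')
    (j : ℕ) : ∀ C ∈ Cs.set j C', P C := by
  intro C hC
  rcases List.mem_or_eq_of_mem_set hC with h' | h'
  · exact h C h'
  · rw [h']; exact hC'

/-- Blocks of `Cs.eraseIdx j` are blocks of `Cs`. [folklore] -/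
theorem forall_mem_eraseIdx {Cs : List (LoopSeq d)} {P : LoopSeq d → Prop} (h : ∀ C ∈ Cs, P C) (j : ℕ) :
    ∀ C ∈ Cs.eraseIdx j, P C := fun C hC => h C (List.mem_of_mem_eraseIdx hC)

/-- **Blockwise operator sums are the operator sums of the flattening**, for any one-block operator with the append law.
[folklore] -/
theorem flatten_decomp {M : Type*} [CommRing M] (opsum : LoopSeq d → (LoopSeq d → M) → M)
    (happ : ∀ (A B : LoopSeq d) (g : LoopSeq d → M), (∀ l ∈ A, l ≠ []) → (∀ l ∈ B, l ≠ []) →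
      opsum (A ++ B) g = opsum A (fun u => g (u ++ B)) + opsum B (fun u => g (A ++ u)))
    (hcongr : ∀ (A : LoopSeq d) (g g' : LoopSeq d → M), (∀ u, g u = g' u) → opsum A g = opsum A g') :
    ∀ (Cs : List (LoopSeq d)), (∀ C ∈ Cs, ∀ l ∈ C, l ≠ []) → ∀ (B₀ : LoopSeq d), (∀ l ∈ B₀, l ≠ []) →
      ∀ g : LoopSeq d → M, opsum (B₀ ++ Cs.flatten) g =
        opsum B₀ (fun A => g (A ++ Cs.flatten)) + ∑ j : Fin Cs.length, opsum (Cs.get j) (fun C' => g (B₀ ++ (Cs.set j C').flatten)) := by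
  intro Cs
  induction Cs with
  | nil =>
    intro _ B₀ _ g
    have z : ∀ f : Fin ([] : List (LoopSeq d)).length → M, ∑ j, f j = 0 := fun f => Fin.sum_univ_zero f
    rw [z, add_zero, List.flatten_nil, List.append_nil]
    exact hcongr B₀ _ _ fun u => by rw [List.append_nil]
  | cons C rest ih =>
    intro hCs B₀ hB₀ g
    have hC : ∀ l ∈ C, l ≠ [] := hCs C (by simp)
    have hrest : ∀ C' ∈ rest, ∀ l ∈ C', l ≠ [] := fun C' h => hCs C' (List.mem_cons_of_mem C h)
    have e1 : B₀ ++ (C :: rest).flatten = (B₀ ++ C) ++ rest.flatten := by rw [List.flatten_cons, List.append_assoc]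
    rw [e1, ih hrest (B₀ ++ C) (append_ne_nil_of hB₀ hC), happ B₀ C _ hB₀ hC,
      blockSum_cons opsum (fun L => g (B₀ ++ L.flatten)) C rest, add_assoc]
    congr 1
    · exact hcongr B₀ _ _ fun u => by rw [List.flatten_cons, List.append_assoc]
    · congr 1
      · exact hcongr C _ _ fun u => by rw [List.flatten_cons, List.append_assoc]
      · refine Finset.sum_congr rfl fun j _ => hcongr _ _ _ fun u => ?_
        rw [List.flatten_cons, List.append_assoc]

/-- **The blockwise split/deform Catalan weight of a state is at most `|u| θ Φ_K(u)`** (`u` the flattening,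
`Φ_K = K^ι Π C`, `θ = 2/K + |β|·2P·256·K⁴`): the four positive weight sums of the uncentered block and of every centered block,
with the other blocks carried along, add up to those of `u`, which the tree's `operator_weight_le` bounds.
[cite: Chatterjee2019LargeN, Lemma 10.1 (the Catalan weight)] -/
theorem block_weight_le {K : ℝ} (hK : 1 ≤ K) (β : ℝ) {B₀ : LoopSeq d} (hB₀ : IsLoopSeq B₀)
    {Cs : List (LoopSeq d)} (hCs : ∀ C ∈ Cs, IsLoopSeq C) (hne : B₀ ++ Cs.flatten ≠ []) :
    ((∑ o : InvIdx B₀, K ^ (B₀.negSplitAt o ++ Cs.flatten).index * catProd (B₀.negSplitAt o ++ Cs.flatten))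
      + (∑ o : SameIdx B₀, K ^ (B₀.posSplitAt o ++ Cs.flatten).index * catProd (B₀.posSplitAt o ++ Cs.flatten))
      + |β| * ((∑ o : DeformIdx B₀, K ^ (B₀.negDeformAt o ++ Cs.flatten).index * catProd (B₀.negDeformAt o ++ Cs.flatten))
        + ∑ o : DeformIdx B₀, K ^ (B₀.posDeformAt o ++ Cs.flatten).index * catProd (B₀.posDeformAt o ++ Cs.flatten)))
    + ∑ j : Fin Cs.length,
      ((∑ o : InvIdx (Cs.get j), K ^ (B₀ ++ (Cs.set j ((Cs.get j).negSplitAt o)).flatten).index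
            * catProd (B₀ ++ (Cs.set j ((Cs.get j).negSplitAt o)).flatten))
        + (∑ o : SameIdx (Cs.get j), K ^ (B₀ ++ (Cs.set j ((Cs.get j).posSplitAt o)).flatten).index
            * catProd (B₀ ++ (Cs.set j ((Cs.get j).posSplitAt o)).flatten))
        + |β| * ((∑ o : DeformIdx (Cs.get j), K ^ (B₀ ++ (Cs.set j ((Cs.get j).negDeformAt o)).flatten).index
              * catProd (B₀ ++ (Cs.set j ((Cs.get j).negDeformAt o)).flatten))
          + ∑ o : DeformIdx (Cs.get j), K ^ (B₀ ++ (Cs.set j ((Cs.get j).posDeformAt o)).flatten).index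
              * catProd (B₀ ++ (Cs.set j ((Cs.get j).posDeformAt o)).flatten)))
    ≤ ((B₀ ++ Cs.flatten).len : ℝ) * ((2 / K + |β| * (2 * ((2 * (d - 1) : ℕ) : ℝ) * 256 * K ^ 4))
        * (K ^ (B₀ ++ Cs.flatten).index * catProd (B₀ ++ Cs.flatten))) := by
  have hB₀n : ∀ l ∈ B₀, l ≠ [] := fun l hl => (hB₀ l hl).2
  have hCsn : ∀ C ∈ Cs, ∀ l ∈ C, l ≠ [] := fun C hC l hl => (hCs C hC l hl).2
  set Φ : LoopSeq d → ℝ := fun u => K ^ u.index * catProd u with hΦ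
  -- the four blockwise sums are the sums of the flattening
  have h1 := flatten_decomp (M := ℝ) (fun A g => ∑ o : InvIdx A, g (A.negSplitAt o))
    (fun A B g hA hB => sum_negSplitAt_append hA hB g) (fun A g g' h => Finset.sum_congr rfl fun o _ => h _) Cs hCsn B₀ hB₀n Φ
  have h2 := flatten_decomp (M := ℝ) (fun A g => ∑ o : SameIdx A, g (A.posSplitAt o))
    (fun A B g hA hB => sum_posSplitAt_append hA hB g) (fun A g g' h => Finset.sum_congr rfl fun o _ => h _) Cs hCsn B₀ hB₀n Φ
  have h3 := flatten_decomp (M := ℝ) (fun A g => ∑ o : DeformIdx A, g (A.negDeformAt o))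
    (fun A B g hA hB => sum_negDeformAt_append hA hB g) (fun A g g' h => Finset.sum_congr rfl fun o _ => h _) Cs hCsn B₀ hB₀n Φ
  have h4 := flatten_decomp (M := ℝ) (fun A g => ∑ o : DeformIdx A, g (A.posDeformAt o))
    (fun A B g hA hB => sum_posDeformAt_append hA hB g) (fun A g g' h => Finset.sum_congr rfl fun o _ => h _) Cs hCsn B₀ hB₀n Φ
  simp only [hΦ] at h1 h2 h3 h4
  have hop := operator_weight_le hK β (isLoopSeq_append hB₀ (isLoopSeq_flatten hCs)) hne
  rw [h1, h2, h3, h4] at hop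
  refine le_trans (le_of_eq ?_) hop
  simp only [mul_add, Finset.mul_sum, Finset.sum_add_distrib]
  ring

/-! ## The a priori bound for the coefficients of the centered block products -/

/-- **A priori bound**: if `|coeff_j P(u)| ≤ C L^{|u|}` on genuine `u` for `j ≤ K` (`C, L ≥ 1`), then for `k ≤ K` and every
genuine state `|coeff_k G(B₀; Cs)| ≤ C (1 + (K+1)C)^{m} L^{|B₀| + Σ|C_j|}`. [new (lane)] -/
theorem centered_coeff_bound {K : ℕ} {Cc Lc : ℝ} (hCc : 1 ≤ Cc) (hLc : 1 ≤ Lc) {P : LoopSeq d → PowerSeries ℝ}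
    (hbd : ∀ j, j ≤ K → ∀ u : LoopSeq d, IsLoopSeq u → |coeff j (P u)| ≤ Cc * Lc ^ u.len)
    {G : LoopSeq d → List (LoopSeq d) → PowerSeries ℝ} (hG0 : ∀ B₀ : LoopSeq d, G B₀ [] = P B₀)
    (hGs : ∀ (B₀ C : LoopSeq d) (rest : List (LoopSeq d)), G B₀ (C :: rest) = G (B₀ ++ C) rest - P C * G B₀ rest) :
    ∀ (Cs : List (LoopSeq d)), (∀ C ∈ Cs, IsLoopSeq C) → ∀ (B₀ : LoopSeq d), IsLoopSeq B₀ → ∀ k, k ≤ K →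
      |coeff k (G B₀ Cs)| ≤ Cc * (1 + (K + 1) * Cc) ^ Cs.length * Lc ^ (B₀.len + (Cs.map LoopSeq.len).sum) := by
  intro Cs
  induction Cs with
  | nil =>
    intro _ B₀ hB₀ k hk
    rw [hG0, List.length_nil, pow_zero, mul_one, List.map_nil, List.sum_nil, add_zero]
    exact hbd k hk B₀ hB₀
  | cons C rest ih =>
    intro hCs B₀ hB₀ k hk
    have hC : IsLoopSeq C := hCs C (by simp)
    have hrest : ∀ C' ∈ rest, IsLoopSeq C' := fun C' h => hCs C' (List.mem_cons_of_mem C h)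
    set D : ℝ := 1 + (K + 1) * Cc with hD
    have hD1 : 1 ≤ D := by rw [hD]; nlinarith
    have hLpos : 0 < Lc := by linarith
    rw [hGs, map_sub, PowerSeries.coeff_mul]
    -- the two pieces
    have e1 := ih hrest (B₀ ++ C) (isLoopSeq_append hB₀ hC) k hk
    rw [LoopSeq.len_append] at e1
    have e2 : |∑ q ∈ antidiagonal k, coeff q.1 (P C) * coeff q.2 (G B₀ rest)| ≤
        (K + 1) * Cc * (Cc * D ^ rest.length * Lc ^ (B₀.len + C.len + (rest.map LoopSeq.len).sum)) := by
      calc |∑ q ∈ antidiagonal k, coeff q.1 (P C) * coeff q.2 (G B₀ rest)|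
          ≤ ∑ q ∈ antidiagonal k, |coeff q.1 (P C) * coeff q.2 (G B₀ rest)| := Finset.abs_sum_le_sum_abs _ _
        _ ≤ ∑ q ∈ antidiagonal k, Cc * Lc ^ C.len * (Cc * D ^ rest.length * Lc ^ (B₀.len + (rest.map LoopSeq.len).sum)) := by
            refine Finset.sum_le_sum fun q hq => ?_
            have hq' : q.1 + q.2 = k := Finset.HasAntidiagonal.mem_antidiagonal.mp hq
            rw [abs_mul]
            exact mul_le_mul (hbd q.1 (by omega) C hC) (ih hrest B₀ hB₀ q.2 (by omega)) (abs_nonneg _) (by positivity)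
        _ = (k + 1 : ℕ) * (Cc * Lc ^ C.len * (Cc * D ^ rest.length * Lc ^ (B₀.len + (rest.map LoopSeq.len).sum))) := by
            rw [Finset.sum_const, Finset.Nat.card_antidiagonal, nsmul_eq_mul]
        _ ≤ (K + 1) * Cc * (Cc * D ^ rest.length * Lc ^ (B₀.len + C.len + (rest.map LoopSeq.len).sum)) := by
            have hk' : ((k + 1 : ℕ) : ℝ) ≤ K + 1 := by exact_mod_cast Nat.succ_le_succ hk
            have : Lc ^ C.len * Lc ^ (B₀.len + (rest.map LoopSeq.len).sum) = Lc ^ (B₀.len + C.len + (rest.map LoopSeq.len).sum) := by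
              rw [← pow_add]; congr 1; ring
            calc ((k + 1 : ℕ) : ℝ) * (Cc * Lc ^ C.len * (Cc * D ^ rest.length * Lc ^ (B₀.len + (rest.map LoopSeq.len).sum)))
                = ((k + 1 : ℕ) : ℝ) * Cc * (Cc * D ^ rest.length * (Lc ^ C.len * Lc ^ (B₀.len + (rest.map LoopSeq.len).sum))) := by
                  ring
              _ ≤ (K + 1) * Cc * (Cc * D ^ rest.length * (Lc ^ C.len * Lc ^ (B₀.len + (rest.map LoopSeq.len).sum))) := by
                  gcongr
              _ = _ := by rw [this]
    calc |coeff k (G (B₀ ++ C) rest) - ∑ q ∈ antidiagonal k, coeff q.1 (P C) * coeff q.2 (G B₀ rest)|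
        ≤ |coeff k (G (B₀ ++ C) rest)| + |∑ q ∈ antidiagonal k, coeff q.1 (P C) * coeff q.2 (G B₀ rest)| := abs_sub _ _
      _ ≤ Cc * D ^ rest.length * Lc ^ (B₀.len + C.len + (rest.map LoopSeq.len).sum)
          + (K + 1) * Cc * (Cc * D ^ rest.length * Lc ^ (B₀.len + C.len + (rest.map LoopSeq.len).sum)) := add_le_add e1 e2
      _ = Cc * D ^ (C :: rest).length * Lc ^ (B₀.len + ((C :: rest).map LoopSeq.len).sum) := by
          rw [List.length_cons, pow_succ, List.map_cons, List.sum_cons, hD]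
          ring

/-! ## Congruence of the block operators on genuine inputs -/

section congr

variable {R : Type*} [CommRing R] (b : R)
  (SD TW ME : LoopSeq d → (LoopSeq d → R) → R) (XM : LoopSeq d → LoopSeq d → (LoopSeq d → R) → R)
  (hSD : ∀ (A : LoopSeq d) (g : LoopSeq d → R), SD A g =
    ((∑ o : InvIdx A, g (A.negSplitAt o)) - ∑ o : SameIdx A, g (A.posSplitAt o))
      + b * ((∑ o : DeformIdx A, g (A.negDeformAt o)) - ∑ o : DeformIdx A, g (A.posDeformAt o)))
  (hTW : ∀ (A : LoopSeq d) (g : LoopSeq d → R), TW A g =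
    (∑ o : SameIdx A, g (A.negTwistAt o)) - ∑ o : InvIdx A, g (A.posTwistAt o))
  (hME : ∀ (A : LoopSeq d) (g : LoopSeq d → R), ME A g =
    (∑ o : MergeIdx A, g (A.negMergeAt o)) - ∑ o : MergeIdx A, g (A.posMergeAt o))
  (hXM : ∀ (A B : LoopSeq d) (g : LoopSeq d → R), XM A B g =
    (∑ i : Fin A.length, ∑ j : Fin B.length,
        ∑ q : {xy : Fin (A.get i).length × Fin (B.get j).length // ((B.get j).get xy.2).1 = ((A.get i).get xy.1).1},
          (g (A.take i ++ LoopSeq.prune [Word.negMerge _ q.1.1 _ q.1.2] ++ A.drop (i + 1) ++ B.eraseIdx j)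
            - g (A.take i ++ LoopSeq.prune [Word.posMerge _ q.1.1 _ q.1.2] ++ A.drop (i + 1) ++ B.eraseIdx j)))
    + ∑ j : Fin B.length, ∑ i : Fin A.length,
        ∑ q : {xy : Fin (B.get j).length × Fin (A.get i).length // ((A.get i).get xy.2).1 = ((B.get j).get xy.1).1},
          (g (A.eraseIdx i ++ (B.take j ++ LoopSeq.prune [Word.negMerge _ q.1.1 _ q.1.2] ++ B.drop (j + 1)))
            - g (A.eraseIdx i ++ (B.take j ++ LoopSeq.prune [Word.posMerge _ q.1.1 _ q.1.2] ++ B.drop (j + 1)))))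
include hSD hTW hME hXM

omit hTW hME hXM in
/-- [folklore] -/
theorem SD_congr_gen {A : LoopSeq d} (hA : IsLoopSeq A) {g g' : LoopSeq d → R} (h : ∀ u, IsLoopSeq u → g u = g' u) :
    SD A g = SD A g' := by
  rw [hSD, hSD]
  simp only [h _ (hA.negSplitAt _), h _ (hA.posSplitAt _), h _ (hA.negDeformAt _), h _ (hA.posDeformAt _)]

omit hSD hME hXM in
/-- [folklore] -/
theorem TW_congr_gen {A : LoopSeq d} (hA : IsLoopSeq A) {g g' : LoopSeq d → R} (h : ∀ u, IsLoopSeq u → g u = g' u) :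
    TW A g = TW A g' := by
  rw [hTW, hTW]
  simp only [h _ (hA.negTwistAt _), h _ (hA.posTwistAt _)]

omit hSD hTW hXM in
/-- [folklore] -/
theorem ME_congr_gen {A : LoopSeq d} (hA : IsLoopSeq A) {g g' : LoopSeq d → R} (h : ∀ u, IsLoopSeq u → g u = g' u) :
    ME A g = ME A g' := by
  rw [hME, hME]
  simp only [h _ (hA.negMergeAt _), h _ (hA.posMergeAt _)]

omit hSD hTW hME hXM in
/-- The lists fed to a cross-merge continuation are genuine. [folklore] -/
theorem xm_inputs_genuine {A B : LoopSeq d} (hA : IsLoopSeq A) (hB : IsLoopSeq B) (i : Fin A.length) (j : Fin B.length) :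
    (∀ q : {xy : Fin (A.get i).length × Fin (B.get j).length // ((B.get j).get xy.2).1 = ((A.get i).get xy.1).1},
      IsLoopSeq (A.take i ++ LoopSeq.prune [Word.negMerge _ q.1.1 _ q.1.2] ++ A.drop (i + 1) ++ B.eraseIdx j) ∧
      IsLoopSeq (A.take i ++ LoopSeq.prune [Word.posMerge _ q.1.1 _ q.1.2] ++ A.drop (i + 1) ++ B.eraseIdx j)) ∧
    (∀ q : {xy : Fin (B.get j).length × Fin (A.get i).length // ((A.get i).get xy.2).1 = ((B.get j).get xy.1).1},
      IsLoopSeq (A.eraseIdx i ++ (B.take j ++ LoopSeq.prune [Word.negMerge _ q.1.1 _ q.1.2] ++ B.drop (j + 1))) ∧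
      IsLoopSeq (A.eraseIdx i ++ (B.take j ++ LoopSeq.prune [Word.posMerge _ q.1.1 _ q.1.2] ++ B.drop (j + 1)))) := by
  have hAi := (hA _ (List.get_mem A i)).1.1
  have hBj := (hB _ (List.get_mem B j)).1.1
  refine ⟨fun q => ⟨?_, ?_⟩, fun q => ⟨?_, ?_⟩⟩
  · exact isLoopSeq_append (isLoopSeq_append (isLoopSeq_append (isLoopSeq_take_drop hA i 0).1
      (isLoopSeq_prune_singleton (Word.isLoop_negMerge hAi hBj q.2))) (isLoopSeq_take_drop hA (i + 1) 0).2.1)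
      (isLoopSeq_take_drop hB 0 j).2.2
  · exact isLoopSeq_append (isLoopSeq_append (isLoopSeq_append (isLoopSeq_take_drop hA i 0).1
      (isLoopSeq_prune_singleton (Word.isLoop_posMerge hAi hBj q.2))) (isLoopSeq_take_drop hA (i + 1) 0).2.1)
      (isLoopSeq_take_drop hB 0 j).2.2
  · exact isLoopSeq_append (isLoopSeq_take_drop hA 0 i).2.2 (isLoopSeq_append (isLoopSeq_append
      (isLoopSeq_take_drop hB j 0).1 (isLoopSeq_prune_singleton (Word.isLoop_negMerge hBj hAi q.2)))
      (isLoopSeq_take_drop hB (j + 1) 0).2.1)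
  · exact isLoopSeq_append (isLoopSeq_take_drop hA 0 i).2.2 (isLoopSeq_append (isLoopSeq_append
      (isLoopSeq_take_drop hB j 0).1 (isLoopSeq_prune_singleton (Word.isLoop_posMerge hBj hAi q.2)))
      (isLoopSeq_take_drop hB (j + 1) 0).2.1)

omit hSD hTW hME in
/-- [folklore] -/
theorem XM_congr_gen {A B : LoopSeq d} (hA : IsLoopSeq A) (hB : IsLoopSeq B) {g g' : LoopSeq d → R}
    (h : ∀ u, IsLoopSeq u → g u = g' u) : XM A B g = XM A B g' := by
  rw [hXM, hXM]
  congr 1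
  · refine Finset.sum_congr rfl fun i _ => Finset.sum_congr rfl fun j _ => Finset.sum_congr rfl fun q _ => ?_
    obtain ⟨h1, h2⟩ := (xm_inputs_genuine hA hB i j).1 q
    rw [h _ h1, h _ h2]
  · refine Finset.sum_congr rfl fun j _ => Finset.sum_congr rfl fun i _ => Finset.sum_congr rfl fun q _ => ?_
    obtain ⟨h1, h2⟩ := (xm_inputs_genuine hA hB i j).2 q
    rw [h _ h1, h _ h2]

end congr

end StringDuality

end Summit.QuantumFields.GaugeBoot

end
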